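import Literature.IUT.HodgeArakelov.GaloisPairCyclotomesThetaSync
import Literature.IUT.HodgeArakelov.AbsTopMonoidsNonVacuity
import HarnessLib

/-!
# Bridge B12, `Π`-side junction — NON-VACUITY of `GalCorPiXInput` (proof-only)

Mochizuki, *Inter-universal Teichmüller theory II*, §1, Corollary 1.11 (b), kurims manuscript (Dec. 2020) p. 49
ll. 22–35: the `Aut(G)`-orbit of isomorphisms `μ_Ẑ(G) ⥲ (l·Δ_Θ)(Π)` obtained from `α : Π/Δ ⥲ G` and "the natural
isomorphism `μ_Ẑ(G_k) ⥲ μ_Ẑ(Π_X)` of [AbsTopIII], Corollary 1.10, (c)"; Corollary 1.10, p. 47: "the topological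
`Π`-modules constituted by the domain [`(l·Δ_Θ)(Π)`] and codomain of `(∗mono-Θ_Π)`" [claim: Mochizuki2012,
status: disputed] (IUTchII §1 Cor 1.11, kurims p.49). Record-only typing under the claim key `Mochizuki2012`
(D-0012, disputed); abc-iut cell, layer L6, NV-L6 wave (zero-producer interfaces), node `IUTchII:Cor1.11`,
`plan/L6/MERGE-MAP.md` §8 row B12 (lineage abc-iut-w4-d024).

`GaloisPairCyclotomesThetaSync.lean` (p417560) types the residual `Π`-side input of Cor. 1.11 over Cor. 1.10's
functorial family `D : MonoThetaRigidityData S` as the structure `GalCorPiXInput A D` (the Cor. 1.10 (c)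
isomorphism `μ_Ẑ(Π/Δ) ⥲ (l·Δ_Θ)(Π)`, natural in `Π ⥲ Π*`, `Π`-equivariant). That structure had NO producer in
the tree (it constrains `A` and `D` jointly). This PROOF-ONLY file records its exact non-vacuity status:

* `GalCorPiXInput.exists_cyclotomic` — for EVERY `A : AbsTopMonoids S` there is a family `D` with
  `Nonempty (GalCorPiXInput A D)`, namely the CYCLOTOMIC family `(l·Δ_Θ)(Π) := Π_μ(M^Θ_*(Π)) := μ_Ẑ(Π/Δ)`
  (abc-iut-L4-t1's GENUINE group-theoretic cyclotome of the quotient), `(∗mono-Θ_Π) := id`, `Π` acting through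
  `Π ↠ Π/Δ` by the cyclotomic character (conjugation action `muZhat.instMulDistribMulAction`), transport
  `μ_Ẑ(quotMap h)`; all fourteen laws of `MonoThetaRigidityData` hold by the functor laws / equivariance of
  `μ_Ẑ(−)` PROVED in `GaloisPairCyclotomesBridge.lean` (`galCyclotomeMap_id/_comp/_smul`) and the functor laws
  of `quotMap` (`AbsTopQuotientMaps.lean`), and `corPiX := id` satisfies the three laws of `GalCorPiXInput`
  definitionally. The witness is labelled for what it is: GENUINE on the Galois side (`μ_Ẑ`), TAUTOLOGICAL on
  the `Θ`-side (it does not use the theta quotient) — it certifies that the typed laws of `GalCorPiXInput` are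
  jointly satisfiable with those of `MonoThetaRigidityData` over the genuine `μ_Ẑ`, for every `A`; it says
  nothing about the Cor. 1.10 (c) isomorphism at Cor. 1.10's GENUINE family (FACT-LIST F-0348 on the owner
  side, abc-iut-L4-t1), which remains the named input of record;
* `GalCorPiXInput.exists_of_nonempty_absTopMonoids` / `exists_absTopMonoids_galCorPiXInput_iff` — hence the
  pair `(A, D, GalCorPiXInput A D)` is inhabited EXACTLY under the inhabitation condition of `AbsTopMonoids S`
  (`AbsTopMonoids.nonempty_iff`: (H1) `Δ` characteristic ∧ (H2) `Π/Δ ≅ G_k`);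
* `exists_cor111FunctorCor110_multiradiallyDefined_of_rigidity` — so, GIVEN the one input that constrains
  `A` alone (the [AbsTopIII] Rmk. 3.2.1 rigidity isomorphism `R : GalRigidityInput A`), the Cor. 1.11 functor
  of record over Cor. 1.10's family shape EXISTS and is multiradially defined for SOME `(D, C)` and every twist.

HONEST FRAMING: bookkeeping over the cell's typed interfaces and abc-iut-L4-t1's genuine cyclotome; no new
definition, no named `Prop` fact, nothing of another seat edited or restated; «witnessed» ≠ «genuine at
Cor. 1.10's family» ≠ «endorsed»; nothing here bears on [IUTchIII] Cor. 3.12; typed ≠ discharged.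
-/

namespace Literature.IUT.HodgeArakelov

open CategoryTheory
open Literature.AnabelianGeometry.AbsoluteAnabelian

universe u

variable {S : ThetaSetting.{u}}

namespace GalCorPiXInput

/-- **Non-vacuity of `GalCorPiXInput` (IUTchII:Cor1.11 (b), `Π`-side) — the CYCLOTOMIC family.** For every
`A : AbsTopMonoids S` there is a functorial family `D : MonoThetaRigidityData S` (Cor. 1.10 output shape) with
`(l·Δ_Θ)(Π) = Π_μ(M^Θ_*(Π)) = μ_Ẑ(Π/Δ)` ON THE NOSE (second conjunct), `(∗mono-Θ_Π) = id`, `Π` acting through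
`Π ↠ Π/Δ` by conjugation, transport `μ_Ẑ(quotMap h)`, together with a `GalCorPiXInput A D` (`corPiX := id`).
GENUINE on the Galois side, TAUTOLOGICAL on the `Θ`-side (labelled so); certifies joint satisfiability of the
typed laws, not the Cor. 1.10 (c) isomorphism at Cor. 1.10's genuine family (F-0348, owner side).
[claim: Mochizuki2012, status: disputed] (IUTchII §1 Cor 1.11, kurims p.49) -/
theorem exists_cyclotomic [CompactSpace S.Gk] (A : AbsTopMonoids S) :
    ∃ D : MonoThetaRigidityData S,
      Nonempty (GalCorPiXInput A D) ∧ ∀ P : IsoClass S.PiX, (D.intCyc P : Type u) = ↥(A.quotObj P).galCyclotome := by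
  classical
  -- `Π` acts on `μ_Ẑ(Π/Δ)` through `Π ↠ Π/Δ` and the conjugation action (cyclotomic character)
  let act : ∀ P : IsoClass S.PiX, P.G →* MulAut ↥(A.quotObj P).galCyclotome := fun P =>
    haveI := (A.quotObj P).compactSpace_carrier
    (MulDistribMulAction.toMulAut (A.quotObj P).G ↥(A.quotObj P).galCyclotome).comp
      (QuotientGroup.mk' (A.Delta P))
  -- transport `μ_Ẑ(quotMap h)`
  let tr : ∀ P Q : IsoClass S.PiX, (P ⟶ Q) →
      (↥(A.quotObj P).galCyclotome ≃* ↥(A.quotObj Q).galCyclotome) := fun _ _ h =>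
    IsoClass.galCyclotomeMap (A.quotMap h)
  have tr_id : ∀ P : IsoClass S.PiX, tr P P (𝟙 P) = MulEquiv.refl _ := fun P => by
    show IsoClass.galCyclotomeMap (A.quotMap (𝟙 P)) = _
    rw [A.quotMap_id]
    exact IsoClass.galCyclotomeMap_id _
  have tr_comp : ∀ {P Q R : IsoClass S.PiX} (f : P ⟶ Q) (g : Q ⟶ R),
      tr P R (f ≫ g) = (tr P Q f).trans (tr Q R g) := fun f g => by
    show IsoClass.galCyclotomeMap (A.quotMap (f ≫ g)) = _
    rw [A.quotMap_comp]
    exact IsoClass.galCyclotomeMap_comp _ _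
  have tr_act : ∀ {P Q : IsoClass S.PiX} (f : P ⟶ Q) (x : P.G) (m : ↥(A.quotObj P).galCyclotome),
      tr P Q f (act P x m) = act Q (IsoClass.homIso f x) (tr P Q f m) := fun f x m =>
    IsoClass.galCyclotomeMap_smul (A.quotMap f) (QuotientGroup.mk x) m
  refine ⟨{ intCyc := fun P => CommGrpCat.of ↥(A.quotObj P).galCyclotome
            extCyc := fun P => CommGrpCat.of ↥(A.quotObj P).galCyclotome
            actInt := act
            actExt := act
            monoTheta := fun _ => MulEquiv.refl _
            monoTheta_equivariant := fun _ _ _ => rfl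
            mapInt := fun {P Q} h => tr P Q h
            mapInt_id := tr_id
            mapInt_comp := tr_comp
            mapExt := fun {P Q} h => tr P Q h
            mapExt_id := tr_id
            mapExt_comp := tr_comp
            mapInt_act := tr_act
            mapExt_act := tr_act
            monoTheta_natural := fun _ _ => rfl },
    ⟨{ corPiX := fun _ => MulEquiv.refl _
       corPiX_natural := fun _ _ => rfl
       corPiX_equivariant := fun _ _ _ => rfl }⟩, fun _ => rfl⟩

/-- Hence `GalCorPiXInput A D` is inhabited for some `(A, D)` as soon as `AbsTopMonoids S` is.
[claim: Mochizuki2012, status: disputed] (IUTchII §1 Cor 1.11, kurims p.49) -/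
theorem exists_of_nonempty_absTopMonoids [CompactSpace S.Gk] (h : Nonempty (AbsTopMonoids S)) :
    ∃ (A : AbsTopMonoids S) (D : MonoThetaRigidityData S), Nonempty (GalCorPiXInput A D) := by
  obtain ⟨A⟩ := h
  obtain ⟨D, hD, -⟩ := exists_cyclotomic A
  exact ⟨A, D, hD⟩

/-- **Exact inhabitation condition of the triple `(A, D, GalCorPiXInput A D)`**: it is inhabited iff
`AbsTopMonoids S` is, i.e. (`AbsTopMonoids.nonempty_iff`, abc-iut-w5-d113) iff (H1) `Δ ⊆ Π^tp_{X̲̲_k}` is carried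
onto itself by every automorphism of topological groups and (H2) `Π^tp_{X̲̲_k}/Δ ≅ G_k` — the `Π`-side input
of Cor. 1.11 adds NO inhabitation constraint beyond Ex. 1.8's. [claim: Mochizuki2012, status: disputed]
(IUTchII §1 Cor 1.11, kurims p.49) -/
theorem exists_absTopMonoids_galCorPiXInput_iff [CompactSpace S.Gk] :
    (∃ (A : AbsTopMonoids S) (D : MonoThetaRigidityData S), Nonempty (GalCorPiXInput A D)) ↔
      (∀ f : S.PiX ≃ₜ* S.PiX, S.DeltaX.map f.toMulEquiv.toMonoidHom = S.DeltaX) ∧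
        Nonempty (TopGroup.quot S.PiX S.DeltaX ≃ₜ* S.Gk) := by
  rw [← AbsTopMonoids.nonempty_iff]
  exact ⟨fun ⟨A, _, _⟩ => ⟨A⟩, exists_of_nonempty_absTopMonoids⟩

end GalCorPiXInput

/-- **IUTchII:Cor1.11 over Cor. 1.10's family shape, GIVEN the rigidity input only**: for every
`A : AbsTopMonoids S`, every twist datum `T` and the one input constraining `A` alone — the [AbsTopIII]
Rmk. 3.2.1 rigidity isomorphism `R : GalRigidityInput A` — there are a family `D` and a Cor. 1.10 (c) datum
`C : GalCorPiXInput A D` (the cyclotomic ones) for which the functor `ℛ → ℱ` of record `cor111FunctorCor110`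
is multiradially defined. [claim: Mochizuki2012, status: disputed] (IUTchII §1 Cor 1.11, kurims p.49) -/
theorem exists_cor111FunctorCor110_multiradiallyDefined_of_rigidity [CompactSpace S.Gk] {A : AbsTopMonoids S}
    (T : GalTwistInput S) (R : GalRigidityInput A) (Γ : Subgroup ZHatUnits) (Γ' : Type u) [Group Γ'] :
    ∃ (D : MonoThetaRigidityData S) (C : GalCorPiXInput A D),
      ((ex18iii S Γ').toDagger (cor111FunctorCor110 T R D C Γ Γ')).IsMultiradiallyDefined := by
  obtain ⟨D, ⟨C⟩, -⟩ := GalCorPiXInput.exists_cyclotomic A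
  exact ⟨D, C, cor111FunctorCor110_multiradiallyDefined T R D C Γ Γ'⟩

/-- For the cyclotomic witness the orbit (b) `(*bs-Gal_{G,Π})` of the B12 instance over Cor. 1.10's family
shape is non-empty at every `(Π, G)` and consists of `Π`-semilinear maps (`orbitB_equivariant`); recorded as the
existence of `(D, C)` with a non-empty orbit (b) everywhere. [claim: Mochizuki2012, status: disputed]
(IUTchII §1 Cor 1.11, kurims p.49) -/
theorem exists_ofGaloisCyclotomeCor110_orbitB_nonempty [CompactSpace S.Gk] {A : AbsTopMonoids S}
    (T : GalTwistInput S) (R : GalRigidityInput A) :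
    ∃ (D : MonoThetaRigidityData S) (C : GalCorPiXInput A D), ∀ (P : IsoClass S.PiX) (G : IsoClass S.Gk),
      ((GaloisPairRigidityData.ofGaloisCyclotomeCor110 T R D C).orbitB P G).Nonempty := by
  obtain ⟨D, ⟨C⟩, -⟩ := GalCorPiXInput.exists_cyclotomic A
  exact ⟨D, C, fun P G => ofGaloisCyclotome_orbitB_nonempty T R _ P G⟩

end Literature.IUT.HodgeArakelov
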